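import Literature.MathematicalPhysics.QuantumLattice.DWaveSourceNNNHopping
import Literature.MathematicalPhysics.QuantumLattice.TwistedSpaceGroupUnitary
import HarnessLib

/-!
# The gauge-twisted space group is a symmetry of the `d`-wave pair-SOURCED `t–t'` torus:
# local certificates in the TWISTED orbit state of its eigenvectors (all of `D₄`)

Topic `MathematicalPhysics/QuantumLattice`, family `hubbard`. Companion of `DWaveSourceNNNHopping`
(`dWaveSourceTorusTT' L tp U μ h = H^{tt'}_L − μN − h(Δ_d + Δ_dᴴ)`, the Koma–Tasaki pinning field; local
certificates read in the orbit state over `(U_w D_γ)_{w, γ ∈ S}` for `S ⊆ ker χ_{B₁g}` ONLY — the quarter turn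
maps `h ↦ −h`) and of `TwistedSpaceGroupUnitary` (`T(v, γ, m) = U_v D_γ 𝒢_{j(γ)+2m}`, `𝒢 = e^{iπN̂/2}`,
`j = b1gTwist`: the `b₁g`-odd lattice elements composed with the gauge quarter turn `c ↦ i c`).

WHAT IS ADDED. The gauge quarter turn multiplies a charge-`−2` word by `−1`, exactly compensating the `B₁g`
sign of the `b₁g`-odd lattice elements on the `d_{x²−y²}` pair field: EVERY member of the twisted family fixes
`Δ_d + Δ_dᴴ` (`twistedSpaceGroupUnitary_conj_pairField_add_conjTranspose`), hence commutes with the sourced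
torus for EVERY label set `S ⊆ D₄` (`twistedSpaceGroupUnitary_mul_dWaveSourceTorusTT'` — no `χ_{B₁g} = 1`
hypothesis), and its adjoints preserve the `S^z` eigenspaces (`…_conjTranspose_mulVec_mem_fockSpinZSector`).
Consequently the torus-level soundness theorem of the sourced programme holds with the FULL point group:
`dWaveSourceTorusTT'_re_orbitState_ge_of_twisted_local_certificate_ineq` — a torus identity
`X − c·1 − Σᵢ μᵢ (Dᵢ − νᵢ·1) − κ (u·1 − E_loc) = SOS + Σ[A, Xₖ] + Σₗ (Tₗ Yₗ Tₗᴴ − Yₗ) + Σ(Z(Q−q) + (Q−q)Z')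
 + Σ(C W − W C) + Σ d(Vᴴ − V) + Σ a M` with symmetry defects over twisted members
`Tₗ = U_{wₗ} D_{γₗ} 𝒢_{j(γₗ)+2mₗ}`, `γₗ ∈ S`, `S ∋ 1` closed under products (all eight elements allowed),
proves `c − Σ‖aₖ‖ + Σᵢ μᵢ (gᵢ/L² − νᵢ) + κ (u − E/L²) ≤ Re ω̄^{tw}_ψ(X)` for EVERY unit eigenvector
`A_L ψ = E ψ` with `S^z ψ = M ψ`, `ω̄^{tw}_ψ = orbitState (twistedSpaceGroupUnitary S) ψ`; `…_of_energy_le`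
the `κ ≥ 0`, `E/L² ≤ u` corollary. For the sourced menus of cell hubbard-cq this doubles the usable point
group (`|S| = 8` instead of `4`): a factor-two block reduction of every sourced one-point / energy SDP
(hubbard-obs PAIRCORR-SDP §13.14 (W8) for the unsourced programme). The window form is in
`DWaveSourceNNNHoppingTwistedWindowCertificate`.

HONEST SCOPE. A response AT FIXED `h > 0` is symmetry-allowed and says nothing about `h → 0` after
`L → ∞`. Everything is PROVED (finite matrices); no definition, no named fact.

## References
* T. Koma, H. Tasaki, J. Stat. Phys. 76 (1994) 745–803, §1 (source `H − hO`). [cite: KomaTasaki1994, §1]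
* O. Bratteli, D. W. Robinson, *Operator Algebras and Quantum Statistical Mechanics 2*, §5.2.2 (gauge
  group of the CAR algebra), §6.2.4 (group averages). [cite: BratteliRobinsonII1997, §5.2.2]
* J. Wang et al., Phys. Rev. X 14 (2024) 031006, §III. [cite: WangEtAl2024, §III]
* X. Han, arXiv:2006.06002 (2020), §3 (symmetry constraints `F[U⁻¹OU] = F[O]`). [cite: Han2020Bootstrap, §3]
* D. J. Scalapino, Phys. Rep. 250 (1995) 329, §2 eq. (2.3) (`B₁g` form factor). [cite: Scalapino1995, §2 eq. (2.3)]
-/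

noncomputable section

namespace Literature.MathematicalPhysics.QuantumLattice

open Matrix Finset Complex HubbardWave0 Literature.Probability.LatticeModels
open Literature.MathematicalPhysics.QuantumManyBody.StateRelaxation
open scoped ComplexOrder BigOperators

/-! ### Gauge rotation of pair words -/

section Gauge

variable {ι : Type*} [Fintype ι] [LinearOrder ι]

/-- **A two-annihilator word has charge `−2`**: `𝒢_k (c_a c_b) = (−1)^k (c_a c_b) 𝒢_k`
(`𝒢_k c = i^{3k} c 𝒢_k` twice, `i^{6k} = (−1)^k`). [cite: BratteliRobinsonII1997, §5.2.2] -/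
theorem fockGauge_mul_annihilation_mul_annihilation (k : ℕ) (a b : ι) :
    (fockGauge k : Matrix (Finset ι) (Finset ι) ℂ) * (annihilation a * annihilation b) =
      ((-1 : ℂ) ^ k) • (annihilation a * annihilation b * fockGauge k) := by
  have hI : I ^ (3 * k) * I ^ (3 * k) = (-1 : ℂ) ^ k := by
    rw [← pow_add, show 3 * k + 3 * k = 2 * (3 * k) by ring, pow_mul, I_sq, pow_mul]
    norm_num
  rw [← Matrix.mul_assoc, fockGauge_mul_annihilation, Matrix.smul_mul, Matrix.mul_assoc,
    fockGauge_mul_annihilation, Matrix.mul_smul, smul_smul, hI, ← Matrix.mul_assoc]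

end Gauge

section Torus

variable {L : ℕ} [NeZero L]

/-- (Local to this section, as in `DWaveSourceNNNHopping`.) [folklore] -/
local instance (priority := high) instDecidableEqFermionTorusSrcTw : DecidableEq (FermionTorus 2 L) :=
  LinearOrder.toDecidableEq

/-- `𝒢_k Φ_x = (−1)^k Φ_x 𝒢_k` for the local pair `Φ_x = Σ_e (g e/√2)(c_{x↑}c_{x+e,↓} − c_{x↓}c_{x+e,↑})`.
[cite: BratteliRobinsonII1997, §5.2.2] -/
theorem fockGauge_mul_localPair (g : Site 2 → ℝ) (k : ℕ) (x : TorusSite 2 L) :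
    fockGauge k * localPair g L x = ((-1 : ℂ) ^ k) • (localPair g L x * fockGauge k) := by
  unfold localPair
  rw [Finset.mul_sum, Finset.sum_mul, Finset.smul_sum]
  refine Finset.sum_congr rfl fun e _ => ?_
  rw [Matrix.mul_smul, Matrix.mul_sub, fockGauge_mul_annihilation_mul_annihilation,
    fockGauge_mul_annihilation_mul_annihilation, ← smul_sub, Matrix.smul_mul, Matrix.sub_mul, smul_comm]

/-- `𝒢_k Δ_g = (−1)^k Δ_g 𝒢_k` for the pair field `Δ_g = Σ_x Φ_x`. [cite: BratteliRobinsonII1997, §5.2.2] -/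
theorem fockGauge_mul_pairField (g : Site 2 → ℝ) (k : ℕ) :
    fockGauge k * pairField g L = ((-1 : ℂ) ^ k) • (pairField g L * fockGauge k) := by
  unfold pairField
  rw [Finset.mul_sum, Finset.sum_mul, Finset.smul_sum]
  exact Finset.sum_congr rfl fun x _ => fockGauge_mul_localPair g k x

/-- **`𝒢_k (Δ_g + Δ_gᴴ) 𝒢_kᴴ = (−1)^k (Δ_g + Δ_gᴴ)`**: the Hermitian pair operator of Koma–Tasaki changes
sign under the gauge quarter turn. [cite: BratteliRobinsonII1997, §5.2.2] -/
theorem fockGauge_conj_pairField_add_conjTranspose (g : Site 2 → ℝ) (k : ℕ) :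
    fockGauge k * (pairField g L + (pairField g L)ᴴ) * (fockGauge k)ᴴ =
      ((-1 : ℂ) ^ k) • (pairField g L + (pairField g L)ᴴ) := by
  have h1 : fockGauge k * pairField g L * (fockGauge k)ᴴ = ((-1 : ℂ) ^ k) • pairField g L := by
    rw [fockGauge_mul_pairField, Matrix.smul_mul, Matrix.mul_assoc, fockGauge_mul_conjTranspose_self,
      Matrix.mul_one]
  have h2 : fockGauge k * (pairField g L)ᴴ * (fockGauge k)ᴴ = ((-1 : ℂ) ^ k) • (pairField g L)ᴴ := by
    have h := congrArg conjTranspose h1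
    rw [conjTranspose_mul, conjTranspose_mul, conjTranspose_conjTranspose, ← Matrix.mul_assoc,
      conjTranspose_smul, star_pow, star_neg, star_one] at h
    exact h
  rw [Matrix.mul_add, Matrix.add_mul, h1, h2, smul_add]

/-- `χ_{B₁g}` is real: `star (χ_{B₁g} γ) = χ_{B₁g} γ`. [cite: Scalapino1995, §2 eq. (2.3)] -/
theorem star_b1gChar (γ : DihedralGroup 4) : star (b1gChar γ) = b1gChar γ := by
  cases γ <;> simp [b1gChar]

/-- `χ_{B₁g} γ` is the real sign `b1gSign γ`. [cite: Scalapino1995, §2 eq. (2.3)] -/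
theorem b1gChar_eq_b1gSign (γ : DihedralGroup 4) : b1gChar γ = ((b1gSign γ : ℝ) : ℂ) := by
  cases γ <;> simp [b1gChar, b1gSign]

/-- **The sign bookkeeping of the twist**: `(−1)^{j(γ)+2m} · χ_{B₁g}(γ) = 1`. [cite: Scalapino1995, §2 eq. (2.3)] -/
theorem neg_one_pow_twistExp_mul_b1gChar (γ : DihedralGroup 4) (m : Fin 2) :
    ((-1 : ℂ) ^ twistExp γ m) * b1gChar γ = 1 := by
  rw [b1gChar_eq_b1gSign, b1gSign_eq_neg_one_pow_b1gTwist, twistExp, pow_add, pow_mul]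
  push_cast
  rw [neg_one_sq, one_pow, mul_one, ← pow_add, ← two_mul, pow_mul, neg_one_sq, one_pow]

/-- **`(U_w D_γ)(Δ_d + Δ_dᴴ)(U_w D_γ)ᴴ = χ_{B₁g}(γ) · (Δ_d + Δ_dᴴ)`** for every `γ ∈ D₄` (`Δ_d` is translation
invariant and spans `B₁g`). [cite: Scalapino1995, §2 eq. (2.3)] -/
theorem d4Affine_conj_pairField_add_conjTranspose (γ : DihedralGroup 4) (w : TorusSite 2 L) :
    (fockTranslate w).val * (fockD4 (L := L) γ).val * (pairField dWaveFormFactor L + (pairField dWaveFormFactor L)ᴴ) *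
        ((fockTranslate w).val * (fockD4 (L := L) γ).val)ᴴ =
      b1gChar γ • (pairField dWaveFormFactor L + (pairField dWaveFormFactor L)ᴴ) := by
  rw [d4Affine_conj, relabel_add, relabel_conjTranspose, relabel_d4Perm_pairField_dWave, conjTranspose_smul,
    star_b1gChar, ← smul_add, relabel_smul, relabel_add, relabel_conjTranspose, relabel_translate_pairField]

/-- **Every member of the twisted space group FIXES the Hermitian `d`-wave pair operator**:
`T(v, γ, m)(Δ_d + Δ_dᴴ)T(v, γ, m)ᴴ = Δ_d + Δ_dᴴ` for EVERY `γ ∈ D₄` (the gauge sign `(−1)^{j(γ)+2m}` cancels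
`χ_{B₁g}(γ)`). [cite: BratteliRobinsonII1997, §5.2.2] [cite: Scalapino1995, §2 eq. (2.3)] -/
theorem twistedSpaceGroupUnitary_conj_pairField_add_conjTranspose (S : Finset (DihedralGroup 4))
    (g : (TorusSite 2 L × ↥S) × Fin 2) :
    twistedSpaceGroupUnitary S g * (pairField dWaveFormFactor L + (pairField dWaveFormFactor L)ᴴ) *
        (twistedSpaceGroupUnitary S g)ᴴ = pairField dWaveFormFactor L + (pairField dWaveFormFactor L)ᴴ := by
  obtain ⟨⟨v, γ, hγ⟩, m⟩ := g
  rw [twistedSpaceGroupUnitary_apply, conjTranspose_mul]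
  dsimp only
  rw [show spaceGroupUnitary S (v, ⟨γ, hγ⟩) * fockGauge (twistExp γ m) *
        (pairField dWaveFormFactor L + (pairField dWaveFormFactor L)ᴴ) *
        ((fockGauge (twistExp γ m))ᴴ * (spaceGroupUnitary S (v, ⟨γ, hγ⟩))ᴴ) =
      spaceGroupUnitary S (v, ⟨γ, hγ⟩) *
        (fockGauge (twistExp γ m) * (pairField dWaveFormFactor L + (pairField dWaveFormFactor L)ᴴ) *
          (fockGauge (twistExp γ m))ᴴ) * (spaceGroupUnitary S (v, ⟨γ, hγ⟩))ᴴ by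
      simp only [Matrix.mul_assoc],
    fockGauge_conj_pairField_add_conjTranspose, Matrix.mul_smul, Matrix.smul_mul,
    show spaceGroupUnitary S (v, ⟨γ, hγ⟩) * (pairField dWaveFormFactor L + (pairField dWaveFormFactor L)ᴴ) *
        (spaceGroupUnitary S (v, ⟨γ, hγ⟩))ᴴ =
      (fockTranslate v).val * (fockD4 (L := L) γ).val * (pairField dWaveFormFactor L + (pairField dWaveFormFactor L)ᴴ) *
        ((fockTranslate v).val * (fockD4 (L := L) γ).val)ᴴ from rfl,
    d4Affine_conj_pairField_add_conjTranspose, smul_smul, neg_one_pow_twistExp_mul_b1gChar, one_smul]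

/-- `T(g)(Δ_d + Δ_dᴴ) = (Δ_d + Δ_dᴴ)T(g)` (commutator form). [cite: BratteliRobinsonII1997, §5.2.2] -/
theorem twistedSpaceGroupUnitary_mul_pairField_add_conjTranspose (S : Finset (DihedralGroup 4))
    (g : (TorusSite 2 L × ↥S) × Fin 2) :
    twistedSpaceGroupUnitary S g * (pairField dWaveFormFactor L + (pairField dWaveFormFactor L)ᴴ) =
      (pairField dWaveFormFactor L + (pairField dWaveFormFactor L)ᴴ) * twistedSpaceGroupUnitary S g := by
  have h := congrArg (· * twistedSpaceGroupUnitary S g) (twistedSpaceGroupUnitary_conj_pairField_add_conjTranspose (L := L) S g)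
  rwa [Matrix.mul_assoc, twistedSpaceGroupUnitary_conjTranspose_mul_self, Matrix.mul_one] at h

/-- `T(g)` conserves the particle number: `T(g) N = N T(g)`. [cite: BratteliRobinsonII1997, §5.2.2] -/
theorem twistedSpaceGroupUnitary_mul_totalNumber (S : Finset (DihedralGroup 4))
    (g : (TorusSite 2 L × ↥S) × Fin 2) :
    twistedSpaceGroupUnitary S g * (totalNumber : Matrix (Finset (Orb (FermionTorus 2 L))) _ ℂ) =
      totalNumber * twistedSpaceGroupUnitary S g := by
  have hU := commute_totalNumberOp_spaceGroupUnitary (L := L) S g.1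
  have hG : Commute (fockGauge (twistExp (g.1.2 : DihedralGroup 4) g.2))
      (totalNumberOp : Matrix (Finset (Orb (FermionTorus 2 L))) _ ℂ) :=
    Commute.fockGauge_of_totalNumberOp (Commute.refl _) _
  rw [← totalNumberOp_eq_totalNumber, twistedSpaceGroupUnitary_apply, Matrix.mul_assoc, hG.eq, ← Matrix.mul_assoc,
    ← hU.eq, Matrix.mul_assoc]

/-- **The twisted space group commutes with the pair-SOURCED `t–t'` torus for EVERY label set `S ⊆ D₄`**:
`T(g) A_L = A_L T(g)`, `A_L = dWaveSourceTorusTT' L tp U μ h` (no `χ_{B₁g} = 1` hypothesis — contrast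
`spaceGroupUnitary_mul_dWaveSourceTorusTT'`). [cite: KomaTasaki1994, §1] [cite: BratteliRobinsonII1997, §5.2.2] -/
theorem twistedSpaceGroupUnitary_mul_dWaveSourceTorusTT' (S : Finset (DihedralGroup 4)) (tp U μ h : ℝ)
    (g : (TorusSite 2 L × ↥S) × Fin 2) :
    twistedSpaceGroupUnitary S g * dWaveSourceTorusTT' L tp U μ h =
      dWaveSourceTorusTT' L tp U μ h * twistedSpaceGroupUnitary S g := by
  rw [dWaveSourceTorusTT', Matrix.mul_sub, Matrix.mul_sub, Matrix.sub_mul, Matrix.sub_mul, Matrix.mul_smul,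
    Matrix.smul_mul, Matrix.mul_smul, Matrix.smul_mul, twistedSpaceGroupUnitary_mul_hubbardTorusTT',
    twistedSpaceGroupUnitary_mul_totalNumber, twistedSpaceGroupUnitary_mul_pairField_add_conjTranspose]

omit [NeZero L] in
/-- The gauge rotation commutes with `S^z` (both conserve every occupation number). [cite: BratteliRobinsonII1997, §5.2.2] -/
theorem fockGauge_commute_spinZ (k : ℕ) :
    Commute (fockGauge k) (HubbardWave0.spinZ : Matrix (Finset (Orb (FermionTorus 2 L))) _ ℂ) := by
  refine Commute.fockGauge_of_totalNumberOp ?_ k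
  unfold HubbardWave0.spinZ
  exact (Commute.sum_right _ _ _ fun x _ =>
    (commute_totalNumberOp_numberOp x 0).sub_right (commute_totalNumberOp_numberOp x 1)).smul_right _

omit [NeZero L] in
/-- The gauge rotation preserves the `S^z` eigenspaces. [cite: Han2020Bootstrap, §3] -/
theorem fockGauge_mulVec_mem_fockSpinZSector (k : ℕ) {M : ℝ} {ψ : Fock (Orb (FermionTorus 2 L))}
    (hψ : ψ ∈ fockSpinZSector M) : fockGauge k *ᵥ ψ ∈ fockSpinZSector M := by
  rw [mem_fockSpinZSector_iff] at hψ ⊢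
  rw [mulVec_mulVec, ← (fockGauge_commute_spinZ k).eq, ← mulVec_mulVec, hψ, mulVec_smul]

/-- `T(g)ᴴ` preserves the `S^z` eigenspaces (the twisted family conserves `N_σ`). [cite: Han2020Bootstrap, §3] -/
theorem twistedSpaceGroupUnitary_conjTranspose_mulVec_mem_fockSpinZSector (S : Finset (DihedralGroup 4))
    (g : (TorusSite 2 L × ↥S) × Fin 2) {M : ℝ} {ψ : Fock (Orb (FermionTorus 2 L))} (hψ : ψ ∈ fockSpinZSector M) :
    (twistedSpaceGroupUnitary S g)ᴴ *ᵥ ψ ∈ fockSpinZSector M := by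
  rw [twistedSpaceGroupUnitary_apply, conjTranspose_mul, ← mulVec_mulVec, conjTranspose_fockGauge]
  exact fockGauge_mulVec_mem_fockSpinZSector _ (spaceGroupUnitary_conjTranspose_mulVec_mem_fockSpinZSector S g.1 hψ)

end Torus

/-! ### The torus theorem: a local certificate with TWISTED symmetry defects read in the twisted orbit state of
an eigenvector of the sourced Hamiltonian -/

section Certificate

variable {L : ℕ} [NeZero L]

/-- (Local to this section, as in `DWaveSourceNNNHopping`.) [folklore] -/
local instance (priority := high) instDecidableEqFermionTorusSrcTwCert : DecidableEq (FermionTorus 2 L) :=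
  LinearOrder.toDecidableEq

/-- **Certificate with an energy constraint and TWISTED symmetry defects ⇒ twisted-orbit-averaged expectation of
a local observable in EVERY `S^z`-eigenvector eigenstate of the pair-sourced `t–t'` torus — full point group.**
Let `A = dWaveSourceTorusTT' L tp U μ h`, `K = fockSpinZSector M`, `ψ ∈ K` a unit vector with `A ψ = E ψ`,
`S ⊆ D₄` ANY finite set of labels containing `1` and closed under multiplication (all eight elements allowed),
`ω̄^{tw}_ψ` the orbit state over the twisted family `T(v, γ, m) = U_v D_γ 𝒢_{j(γ)+2m}`, `γ ∈ S`. Suppose the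
translates of a local energy `E_loc` sum to `A`, those of observables `Dᵢ` to operators `Gᵢ = gᵢ` on `K`, and the
torus algebra carries
`X − c·1 − Σᵢ μᵢ (Dᵢ − νᵢ·1) − κ (u·1 − E_loc) = Σ Λₐᵦ Oₐᴴ O_b + (Σₖ (A Xₖ − Xₖ A)
  + Σₗ (Tₗ Yₗ Tₗᴴ − Yₗ) + Σᵣ (Zᵣ (Qᵣ − qᵣ) + (Qᵣ − qᵣ) Z'ᵣ) + Σⱼ (Cⱼ Wⱼ − Wⱼ Cⱼ)) + (Σₘ dₘ • (Vₘᴴ − Vₘ) + Σₖ aₖ • Mₖ)`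
with `Λ ⪰ 0`, twisted members `Tₗ = U_{wₗ} D_{γₗ} 𝒢_{j(γₗ)+2mₗ}`, `γₗ ∈ S`, Hermitian `Qᵣ = qᵣ`, `Cⱼ = q'ⱼ` on `K`
(reals; e.g. `Cⱼ = S^z`), real `dₘ`, contractions `Mₖ`. Then
`c − Σₖ ‖aₖ‖ + Σᵢ μᵢ (gᵢ/L² − νᵢ) + κ (u − E/L²) ≤ Re ω̄^{tw}_ψ(X)`. Wang et al. 2024 §III with Han 2020 §3, read in the
symmetrised state of an arbitrary eigenvector (tree `re_orbitState_ge_of_local_certificate_ineq`; the twisted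
family commutes with `A`, `twistedSpaceGroupUnitary_mul_dWaveSourceTorusTT'`). [cite: WangEtAl2024, §III]
[cite: Han2020Bootstrap, §3] -/
theorem dWaveSourceTorusTT'_re_orbitState_ge_of_twisted_local_certificate_ineq (tp U μ h : ℝ) {M : ℝ}
    {S : Finset (DihedralGroup 4)} (h1 : (1 : DihedralGroup 4) ∈ S) (hmul : ∀ a ∈ S, ∀ b ∈ S, a * b ∈ S)
    {ψ : Fock (Orb (FermionTorus 2 L))} (hψK : ψ ∈ fockSpinZSector M)
    (hψ1 : star ψ ⬝ᵥ ψ = 1) {E : ℝ} (hHψ : dWaveSourceTorusTT' L tp U μ h *ᵥ ψ = (E : ℂ) • ψ)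
    (X Eloc : Matrix (Finset (Orb (FermionTorus 2 L))) (Finset (Orb (FermionTorus 2 L))) ℂ)
    (hE : ∑ v : TorusSite 2 L, (fockTranslate v).val * Eloc * (fockTranslate v).valᴴ =
      dWaveSourceTorusTT' L tp U μ h) (κ u : ℝ)
    {δ' : Type*} (dens : Finset δ') (μc ν g : δ' → ℝ)
    (D G : δ' → Matrix (Finset (Orb (FermionTorus 2 L))) (Finset (Orb (FermionTorus 2 L))) ℂ)
    (hD : ∀ i ∈ dens, ∑ v : TorusSite 2 L, (fockTranslate v).val * D i * (fockTranslate v).valᴴ = G i)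
    (hG : ∀ i ∈ dens, ∀ φ ∈ fockSpinZSector (Λ := FermionTorus 2 L) M, G i *ᵥ φ = ((g i : ℝ) : ℂ) • φ)
    {m : Type*} [Fintype m] [DecidableEq m] {Λm : Matrix m m ℂ} (hΛ : Λm.PosSemidef)
    (O : m → Matrix (Finset (Orb (FermionTorus 2 L))) (Finset (Orb (FermionTorus 2 L))) ℂ)
    {κ' : Type*} (s : Finset κ')
    (Xc : κ' → Matrix (Finset (Orb (FermionTorus 2 L))) (Finset (Orb (FermionTorus 2 L))) ℂ)
    {ι : Type*} (tt : Finset ι) (γ : ι → DihedralGroup 4) (hγS : ∀ l ∈ tt, γ l ∈ S)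
    (wv : ι → TorusSite 2 L) (mt : ι → Fin 2)
    (Y : ι → Matrix (Finset (Orb (FermionTorus 2 L))) (Finset (Orb (FermionTorus 2 L))) ℂ)
    {ρ : Type*} (r : Finset ρ)
    (Q Z Z' : ρ → Matrix (Finset (Orb (FermionTorus 2 L))) (Finset (Orb (FermionTorus 2 L))) ℂ)
    (q : ρ → ℝ) (hQh : ∀ i ∈ r, (Q i).IsHermitian)
    (hQ : ∀ i ∈ r, ∀ φ ∈ fockSpinZSector (Λ := FermionTorus 2 L) M, Q i *ᵥ φ = ((q i : ℝ) : ℂ) • φ)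
    {γ' : Type*} (u' : Finset γ')
    (C W : γ' → Matrix (Finset (Orb (FermionTorus 2 L))) (Finset (Orb (FermionTorus 2 L))) ℂ)
    (qc : γ' → ℝ) (hCh : ∀ j ∈ u', (C j).IsHermitian)
    (hC : ∀ j ∈ u', ∀ φ ∈ fockSpinZSector (Λ := FermionTorus 2 L) M, C j *ᵥ φ = ((qc j : ℝ) : ℂ) • φ)
    {δ : Type*} (ah : Finset δ) (dc : δ → ℝ)
    (V : δ → Matrix (Finset (Orb (FermionTorus 2 L))) (Finset (Orb (FermionTorus 2 L))) ℂ)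
    {κ'' : Type*} (w : Finset κ'') (a : κ'' → ℂ)
    (Mw : κ'' → Matrix (Finset (Orb (FermionTorus 2 L))) (Finset (Orb (FermionTorus 2 L))) ℂ)
    (hM : ∀ k ∈ w, (Mw k).IsContraction) {c : ℝ}
    (hcert : X - (c : ℂ) • (1 : Matrix (Finset (Orb (FermionTorus 2 L))) (Finset (Orb (FermionTorus 2 L))) ℂ) -
        ∑ i ∈ dens, ((μc i : ℝ) : ℂ) • (D i - ((ν i : ℝ) : ℂ) •
          (1 : Matrix (Finset (Orb (FermionTorus 2 L))) (Finset (Orb (FermionTorus 2 L))) ℂ)) -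
        ((κ : ℝ) : ℂ) • (((u : ℝ) : ℂ) •
          (1 : Matrix (Finset (Orb (FermionTorus 2 L))) (Finset (Orb (FermionTorus 2 L))) ℂ) - Eloc) =
      gramForm Λm O +
        (∑ k ∈ s, (dWaveSourceTorusTT' L tp U μ h * Xc k - Xc k * dWaveSourceTorusTT' L tp U μ h) +
          ∑ l ∈ tt, ((fockTranslate (wv l)).val * (fockD4 (L := L) (γ l)).val * fockGauge (twistExp (γ l) (mt l)) * Y l *
              ((fockTranslate (wv l)).val * (fockD4 (L := L) (γ l)).val * fockGauge (twistExp (γ l) (mt l)))ᴴ - Y l) +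
          ∑ i ∈ r, (Z i * (Q i - ((q i : ℝ) : ℂ) • 1) + (Q i - ((q i : ℝ) : ℂ) • 1) * Z' i) +
          ∑ j ∈ u', (C j * W j - W j * C j)) +
        (∑ m' ∈ ah, ((dc m' : ℝ) : ℂ) • ((V m')ᴴ - V m') + ∑ k ∈ w, a k • Mw k)) :
    c - ∑ k ∈ w, ‖a k‖ + ∑ i ∈ dens, μc i * (g i / (L : ℝ) ^ 2 - ν i) + κ * (u - E / (L : ℝ) ^ 2) ≤
      (orbitState (twistedSpaceGroupUnitary S) ψ X).re := by
  haveI : Nonempty ↥S := ⟨⟨1, h1⟩⟩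
  have hA : (dWaveSourceTorusTT' L tp U μ h).IsHermitian := dWaveSourceTorusTT'_isHermitian L tp U μ h
  have hUT : ∀ l ∈ tt, ∃ σ : ((TorusSite 2 L × ↥S) × Fin 2) ≃ ((TorusSite 2 L × ↥S) × Fin 2), ∀ g',
      twistedSpaceGroupUnitary S g' *
          ((fockTranslate (wv l)).val * (fockD4 (L := L) (γ l)).val * fockGauge (twistExp (γ l) (mt l))) =
        twistedSpaceGroupUnitary S (σ g') := fun l hl =>
    twistedSpaceGroupUnitary_closed (L := L) hmul (wv l) (hγS l hl) (mt l)
  have h := re_orbitState_ge_of_local_certificate_ineq hA (fockSpinZSector M) hψK hψ1 hHψ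
    (twistedSpaceGroupUnitary S) (fun g' => twistedSpaceGroupUnitary_mul_dWaveSourceTorusTT' S tp U μ h g')
    (fun g' => twistedSpaceGroupUnitary_conjTranspose_mul_self S g')
    (fun g' φ hφ => twistedSpaceGroupUnitary_conjTranspose_mulVec_mem_fockSpinZSector S g' hφ)
    (fun v => (fockTranslate v).val) (fun v => twistedSpaceGroupUnitary_closed_translate h1 hmul v)
    X Eloc hE κ u dens μc ν g D G hD hG hΛ O s Xc tt
    (fun l => (fockTranslate (wv l)).val * (fockD4 (L := L) (γ l)).val * fockGauge (twistExp (γ l) (mt l))) Y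
    hUT r Q Z Z' q hQh hQ u' C W qc hCh hC ah dc V w a Mw hM hcert
  rw [card_torusSite] at h
  push_cast at h
  exact h

/-- **With the energy hypothesis**: `κ ≥ 0` and `E/L² ≤ u` give
`c − Σₖ ‖aₖ‖ + Σᵢ μᵢ (gᵢ/L² − νᵢ) ≤ Re ω̄^{tw}_ψ(X)` for every such eigenvector of the pair-sourced torus.
[cite: WangEtAl2024, §III] -/
theorem dWaveSourceTorusTT'_re_orbitState_ge_of_twisted_local_certificate_ineq_of_energy_le (tp U μ h : ℝ)
    {M : ℝ} {S : Finset (DihedralGroup 4)} (h1 : (1 : DihedralGroup 4) ∈ S) (hmul : ∀ a ∈ S, ∀ b ∈ S, a * b ∈ S)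
    {ψ : Fock (Orb (FermionTorus 2 L))} (hψK : ψ ∈ fockSpinZSector M)
    (hψ1 : star ψ ⬝ᵥ ψ = 1) {E : ℝ} (hHψ : dWaveSourceTorusTT' L tp U μ h *ᵥ ψ = (E : ℂ) • ψ)
    (X Eloc : Matrix (Finset (Orb (FermionTorus 2 L))) (Finset (Orb (FermionTorus 2 L))) ℂ)
    (hE : ∑ v : TorusSite 2 L, (fockTranslate v).val * Eloc * (fockTranslate v).valᴴ =
      dWaveSourceTorusTT' L tp U μ h) {κ u : ℝ} (hκ : 0 ≤ κ) (hEu : E / (L : ℝ) ^ 2 ≤ u)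
    {δ' : Type*} (dens : Finset δ') (μc ν g : δ' → ℝ)
    (D G : δ' → Matrix (Finset (Orb (FermionTorus 2 L))) (Finset (Orb (FermionTorus 2 L))) ℂ)
    (hD : ∀ i ∈ dens, ∑ v : TorusSite 2 L, (fockTranslate v).val * D i * (fockTranslate v).valᴴ = G i)
    (hG : ∀ i ∈ dens, ∀ φ ∈ fockSpinZSector (Λ := FermionTorus 2 L) M, G i *ᵥ φ = ((g i : ℝ) : ℂ) • φ)
    {m : Type*} [Fintype m] [DecidableEq m] {Λm : Matrix m m ℂ} (hΛ : Λm.PosSemidef)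
    (O : m → Matrix (Finset (Orb (FermionTorus 2 L))) (Finset (Orb (FermionTorus 2 L))) ℂ)
    {κ' : Type*} (s : Finset κ')
    (Xc : κ' → Matrix (Finset (Orb (FermionTorus 2 L))) (Finset (Orb (FermionTorus 2 L))) ℂ)
    {ι : Type*} (tt : Finset ι) (γ : ι → DihedralGroup 4) (hγS : ∀ l ∈ tt, γ l ∈ S)
    (wv : ι → TorusSite 2 L) (mt : ι → Fin 2)
    (Y : ι → Matrix (Finset (Orb (FermionTorus 2 L))) (Finset (Orb (FermionTorus 2 L))) ℂ)
    {ρ : Type*} (r : Finset ρ)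
    (Q Z Z' : ρ → Matrix (Finset (Orb (FermionTorus 2 L))) (Finset (Orb (FermionTorus 2 L))) ℂ)
    (q : ρ → ℝ) (hQh : ∀ i ∈ r, (Q i).IsHermitian)
    (hQ : ∀ i ∈ r, ∀ φ ∈ fockSpinZSector (Λ := FermionTorus 2 L) M, Q i *ᵥ φ = ((q i : ℝ) : ℂ) • φ)
    {γ' : Type*} (u' : Finset γ')
    (C W : γ' → Matrix (Finset (Orb (FermionTorus 2 L))) (Finset (Orb (FermionTorus 2 L))) ℂ)
    (qc : γ' → ℝ) (hCh : ∀ j ∈ u', (C j).IsHermitian)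
    (hC : ∀ j ∈ u', ∀ φ ∈ fockSpinZSector (Λ := FermionTorus 2 L) M, C j *ᵥ φ = ((qc j : ℝ) : ℂ) • φ)
    {δ : Type*} (ah : Finset δ) (dc : δ → ℝ)
    (V : δ → Matrix (Finset (Orb (FermionTorus 2 L))) (Finset (Orb (FermionTorus 2 L))) ℂ)
    {κ'' : Type*} (w : Finset κ'') (a : κ'' → ℂ)
    (Mw : κ'' → Matrix (Finset (Orb (FermionTorus 2 L))) (Finset (Orb (FermionTorus 2 L))) ℂ)
    (hM : ∀ k ∈ w, (Mw k).IsContraction) {c : ℝ}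
    (hcert : X - (c : ℂ) • (1 : Matrix (Finset (Orb (FermionTorus 2 L))) (Finset (Orb (FermionTorus 2 L))) ℂ) -
        ∑ i ∈ dens, ((μc i : ℝ) : ℂ) • (D i - ((ν i : ℝ) : ℂ) •
          (1 : Matrix (Finset (Orb (FermionTorus 2 L))) (Finset (Orb (FermionTorus 2 L))) ℂ)) -
        ((κ : ℝ) : ℂ) • (((u : ℝ) : ℂ) •
          (1 : Matrix (Finset (Orb (FermionTorus 2 L))) (Finset (Orb (FermionTorus 2 L))) ℂ) - Eloc) =
      gramForm Λm O +
        (∑ k ∈ s, (dWaveSourceTorusTT' L tp U μ h * Xc k - Xc k * dWaveSourceTorusTT' L tp U μ h) +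
          ∑ l ∈ tt, ((fockTranslate (wv l)).val * (fockD4 (L := L) (γ l)).val * fockGauge (twistExp (γ l) (mt l)) * Y l *
              ((fockTranslate (wv l)).val * (fockD4 (L := L) (γ l)).val * fockGauge (twistExp (γ l) (mt l)))ᴴ - Y l) +
          ∑ i ∈ r, (Z i * (Q i - ((q i : ℝ) : ℂ) • 1) + (Q i - ((q i : ℝ) : ℂ) • 1) * Z' i) +
          ∑ j ∈ u', (C j * W j - W j * C j)) +
        (∑ m' ∈ ah, ((dc m' : ℝ) : ℂ) • ((V m')ᴴ - V m') + ∑ k ∈ w, a k • Mw k)) :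
    c - ∑ k ∈ w, ‖a k‖ + ∑ i ∈ dens, μc i * (g i / (L : ℝ) ^ 2 - ν i) ≤
      (orbitState (twistedSpaceGroupUnitary S) ψ X).re := by
  have h := dWaveSourceTorusTT'_re_orbitState_ge_of_twisted_local_certificate_ineq tp U μ h h1 hmul hψK hψ1 hHψ X
    Eloc hE κ u dens μc ν g D G hD hG hΛ O s Xc tt γ hγS wv mt Y r Q Z Z' q hQh hQ u' C W qc hCh hC ah dc V w a Mw
    hM hcert
  have hslack : 0 ≤ κ * (u - E / (L : ℝ) ^ 2) := mul_nonneg hκ (sub_nonneg.2 hEu)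
  linarith

end Certificate

end Literature.MathematicalPhysics.QuantumLattice

end
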